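import Literature.Geometry.Riemannian.StaticLaplacianTimeDerivative
import Literature.Geometry.Riemannian.HeatPropagationContinuousDataSmooth
import Literature.Geometry.Riemannian.BakryEmeryHeatFlow
import Literature.Geometry.Riemannian.NashEntropy
import HarnessLib

/-!
# `L²` smoothing of the heat flow of a fixed metric: `‖Δ P_τ φ‖₂ ≤ ‖φ‖_∞ √(2V) / τ`

The elementary energy estimate of the heat semigroup of a closed Riemannian manifold `(M, g)`
(e.g. Grigor'yan 2009, §4.3, Exercise 4.41 / the spectral bound `‖Δ e^{τΔ}‖ ≤ 1/(eτ)`; here by the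
energy method): for a smooth solution `W` of `∂ₜ W = Δ_g W` on `M × [a, b]` put
`E₀ = ∫ W²`, `J = ∫ W ΔW ≤ 0`, `E₂ = ∫ (ΔW)²`. Then `E₀' = 2J`, `J' = 2E₂`, `E₂' = 2∫ ΔW Δ²W ≤ 0`
(Green's identities; for `J'` and `E₂'` the commutation `∂ₜ ΔW = Δ ∂ₜW = Δ²W`,
`hasDerivWithinAt_laplaceBeltrami_static`), so that
`Ψ(σ) = (σ−a)² E₂/2 − (σ−a) J/2 + E₀/4` is nonincreasing (`Ψ' = (σ−a)² E₂'/2 ≤ 0`), whence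
`(b−a)² E₂(b)/2 ≤ Ψ(b) ≤ Ψ(a) = E₀(a)/4`:

* `integral_mul_laplaceBeltrami_comm`, `integral_mul_laplaceBeltrami_self_nonpos` — Green on a
  closed manifold (from `integral_mul_laplaceBeltrami_eq_neg_integral_innerDual`);
* `integral_sq_laplaceBeltrami_le_of_isHeatSolutionOn` —
  `∫ (Δ W(b))² ≤ ∫ W(a)² / (2 (b−a)²)`;
* **`integral_sq_laplaceBeltrami_heatValueC_le`** — for a continuous datum `φ` with `|φ| ≤ B`
  and `s < t`: `∫ (Δ_g P_{s→t}φ)² dV_g ≤ 2 B² Vol(M) / (t − s)²` (apply the above on `[r, t]`,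
  `r = (s+t)/2`, to the smooth datum `P_{s→r}φ`, `|P_{s→r}φ| ≤ B`).

Purpose: the smoothing step of Colding's proof of the volume sphere theorem
(`Colding1996_volume_ghClose`): `‖(Δ + m) P_τ (cos d_p + cos d_q)‖₂` is small when
`cos d_p + cos d_q` is uniformly small. Everything here is proved; no definitions, no named facts
(D-0026).

## References

* A. Grigor'yan, *Heat kernel and analysis on manifolds*, AMS/IP (2009), §4.3. [Grigoryan2009]
* P. Topping, *Lectures on the Ricci flow* (2006), §6.3 (energy identities along heat flows).
  [Topping2006]
* J. M. Lee, *Introduction to Riemannian manifolds* (2018), Problem 2-23 (Green). [Lee2018]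
-/

noncomputable section

open Set Function Filter MeasureTheory Measure
open scoped Manifold ContDiff Topology ENNReal NNReal

namespace Literature.Geometry.Riemannian

open Lorentzian Lorentzian.PseudoRiemannianMetric

variable {m : ℕ} {H : Type*} [TopologicalSpace H]
  {I : ModelWithCorners ℝ (EuclideanSpace ℝ (Fin m)) H} [I.Boundaryless]
  {M : Type*} [TopologicalSpace M] [ChartedSpace H M] [IsManifold I ∞ M]
  [T2Space M] [CompactSpace M] [SecondCountableTopology M] [MeasurableSpace M] [BorelSpace M]
  {g : PseudoRiemannianMetric I ∞ (EuclideanSpace ℝ (Fin m)) (TangentSpace I : M → Type _)}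

/-! ### Green's identities on a closed manifold -/

omit [SecondCountableTopology M] in
/-- **`∫ u Δ_g w dV_g = ∫ w Δ_g u dV_g`** for `u, w ∈ C²` on a closed Riemannian manifold (both equal
`−∫ g⁻¹(du, dw) dV_g`). [cite: Lee2018, Problem 2-23 (a)] -/
theorem integral_mul_laplaceBeltrami_comm (hg : g.IsRiemannian) {u w : M → ℝ}
    (hu : ContMDiff I 𝓘(ℝ, ℝ) 2 u) (hw : ContMDiff I 𝓘(ℝ, ℝ) 2 w) :
    ∫ x, u x * g.laplaceBeltrami w x ∂g.riemVolume =
      ∫ x, w x * g.laplaceBeltrami u x ∂g.riemVolume := by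
  have h1le : (1 : ℕ∞ω) ≤ (2 : ℕ∞ω) := by norm_cast
  rw [integral_mul_laplaceBeltrami_eq_neg_integral_innerDual hg (hu.of_le h1le) hw,
    integral_mul_laplaceBeltrami_eq_neg_integral_innerDual hg (hw.of_le h1le) hu]
  congr 1
  exact integral_congr_ae (Eventually.of_forall fun x ↦
    PseudoRiemannianMetric.innerDual_comm _ x _ _)

omit [SecondCountableTopology M] in
/-- **`∫ u Δ_g u dV_g ≤ 0`** for `u ∈ C²` on a closed Riemannian manifold (`= −∫ g⁻¹(du, du) ≤ 0`).
[cite: Lee2018, Problem 2-23 (a)] -/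
theorem integral_mul_laplaceBeltrami_self_nonpos (hg : g.IsRiemannian) {u : M → ℝ}
    (hu : ContMDiff I 𝓘(ℝ, ℝ) 2 u) :
    ∫ x, u x * g.laplaceBeltrami u x ∂g.riemVolume ≤ 0 := by
  have h1le : (1 : ℕ∞ω) ≤ (2 : ℕ∞ω) := by norm_cast
  rw [integral_mul_laplaceBeltrami_eq_neg_integral_innerDual hg (hu.of_le h1le) hu]
  exact neg_nonpos.2 (integral_nonneg fun x ↦
    PseudoRiemannianMetric.innerDual_self_nonneg g hg x _)

/-! ### The energy estimate for a smooth solution -/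

/-- **`∫ (Δ W(b))² dV ≤ ∫ W(a)² dV / (2 (b − a)²)` for a smooth solution of the heat equation of a
fixed metric on `M × [a, b]`** (closed Riemannian manifold; energy method: with `E₀ = ∫ W²`,
`J = ∫ W ΔW ≤ 0`, `E₂ = ∫ (ΔW)²` one has `E₀' = 2J`, `J' = 2E₂`, `E₂' = 2 ∫ ΔW Δ²W ≤ 0`, so
`Ψ(σ) = (σ−a)²E₂/2 − (σ−a)J/2 + E₀/4` is nonincreasing and `(b−a)²E₂(b)/2 ≤ Ψ(b) ≤ Ψ(a) = E₀(a)/4`).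
[cite: Grigoryan2009, §4.3] [cite: Topping2006, §6.3] -/
theorem integral_sq_laplaceBeltrami_le_of_isHeatSolutionOn (hg : g.IsRiemannian)
    {W : ℝ → M → ℝ} {a b : ℝ} (hab : a < b) (hW : IsHeatSolutionOn (fun _ : ℝ ↦ g) W a b) :
    ∫ x, (g.laplaceBeltrami (W b) x) ^ 2 ∂g.riemVolume ≤
      (∫ x, (W a x) ^ 2 ∂g.riemVolume) / (2 * (b - a) ^ 2) := by
  have h2 : (2 : ℕ∞ω) ≤ ((⊤ : ℕ∞) : ℕ∞ω) := WithTop.coe_le_coe.mpr le_top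
  set μ : Measure M := g.riemVolume with hμ
  haveI : IsFiniteMeasure μ := ⟨by rw [hμ]; exact g.riemVolume_univ_lt_top⟩
  set S : Set ℝ := Icc a b with hSdef
  have hS : UniqueDiffOn ℝ S := uniqueDiffOn_Icc hab
  have hS' : S ⊆ closure (interior S) := by
    rw [hSdef, interior_Icc, closure_Ioo hab.ne]
  have hint : interior S = Ioo a b := by rw [hSdef, interior_Icc]
  have hfam : IsContMDiffFamilyOn ∞ (fun _ : ℝ ↦ g) S := isContMDiffFamilyOn_const g S
  -- the Laplacian `L` and the bi-Laplacian `LL` of the solution, smooth on space-time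
  set L : ℝ → M → ℝ := fun r x ↦ g.laplaceBeltrami (W r) x with hL
  set LL : ℝ → M → ℝ := fun r x ↦ g.laplaceBeltrami (L r) x with hLL
  have hWs : ContMDiffOn (I.prod 𝓘(ℝ, ℝ)) 𝓘(ℝ, ℝ) ∞ (fun p : M × ℝ ↦ W p.2 p.1) (univ ×ˢ S) := hW.1
  have hLs : ContMDiffOn (I.prod 𝓘(ℝ, ℝ)) 𝓘(ℝ, ℝ) ∞ (fun p : M × ℝ ↦ L p.2 p.1) (univ ×ˢ S) :=
    hfam.contMDiffOn_laplaceBeltrami hS hWs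
  have hLLs : ContMDiffOn (I.prod 𝓘(ℝ, ℝ)) 𝓘(ℝ, ℝ) ∞ (fun p : M × ℝ ↦ LL p.2 p.1) (univ ×ˢ S) :=
    hfam.contMDiffOn_laplaceBeltrami hS hLs
  have hWc := hWs.continuousOn
  have hLc := hLs.continuousOn
  have hLLc := hLLs.continuousOn
  have hWsl : ∀ r ∈ S, ContMDiff I 𝓘(ℝ, ℝ) ∞ (W r) := fun r hr ↦ contMDiff_slice_of_contMDiffOn hWs hr
  have hLsl : ∀ r ∈ S, ContMDiff I 𝓘(ℝ, ℝ) ∞ (L r) := fun r hr ↦ contMDiff_slice_of_contMDiffOn hLs hr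
  -- time derivatives within `S`: `∂ₜ W = L`, `∂ₜ L = LL`
  have hWd : ∀ r ∈ S, ∀ x, HasDerivWithinAt (fun s ↦ W s x) (L r x) S r := fun r hr x ↦ hW.2 r hr x
  have hLd : ∀ r ∈ S, ∀ x, HasDerivWithinAt (fun s ↦ L s x) (LL r x) S r := fun r hr x ↦
    hasDerivWithinAt_laplaceBeltrami_static g hS hS' hWs hr ((hLsl r hr).of_le h2)
      (fun z ↦ hWd r hr z) x
  -- the energies
  set E₀ : ℝ → ℝ := fun r ↦ ∫ x, W r x * W r x ∂μ with hE₀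
  set J : ℝ → ℝ := fun r ↦ ∫ x, W r x * L r x ∂μ with hJ
  set E₂ : ℝ → ℝ := fun r ↦ ∫ x, L r x * L r x ∂μ with hE₂
  -- continuity on `S`
  have hE₀c : ContinuousOn E₀ S :=
    continuousOn_integral_of_continuousOn_prod μ isClosed_Icc (F := fun r x ↦ W r x * W r x)
      (hWc.mul hWc)
  have hJc : ContinuousOn J S :=
    continuousOn_integral_of_continuousOn_prod μ isClosed_Icc (F := fun r x ↦ W r x * L r x)
      (hWc.mul hLc)
  have hE₂c : ContinuousOn E₂ S :=
    continuousOn_integral_of_continuousOn_prod μ isClosed_Icc (F := fun r x ↦ L r x * L r x)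
      (hLc.mul hLc)
  -- derivatives at interior times
  have hE₀d : ∀ r ∈ Ioo a b, HasDerivAt E₀ (2 * J r) r := by
    intro r hr
    have h1 := hasDerivAt_integral_of_continuousOn_prod μ (S := S)
      (F := fun r x ↦ W r x * W r x) (F' := fun r x ↦ L r x * W r x + W r x * L r x)
      (hWc.mul hWc) ((hLc.mul hWc).add (hWc.mul hLc))
      (fun x r' hr' ↦ (hWd r' hr' x).mul (hWd r' hr' x)) (hint ▸ hr)
    refine h1.congr_deriv ?_
    rw [hJ, ← integral_const_mul]
    exact integral_congr_ae (Eventually.of_forall fun x ↦ by ring)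
  have hJd : ∀ r ∈ Ioo a b, HasDerivAt J (2 * E₂ r) r := by
    intro r hr
    have hrS : r ∈ S := Ioo_subset_Icc_self hr
    have h1 := hasDerivAt_integral_of_continuousOn_prod μ (S := S)
      (F := fun r x ↦ W r x * L r x) (F' := fun r x ↦ L r x * L r x + W r x * LL r x)
      (hWc.mul hLc) ((hLc.mul hLc).add (hWc.mul hLLc))
      (fun x r' hr' ↦ (hWd r' hr' x).mul (hLd r' hr' x)) (hint ▸ hr)
    refine h1.congr_deriv ?_
    -- `∫ W ΔL = ∫ L ΔW = ∫ L²` (Green)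
    have hi1 : Integrable (fun x ↦ L r x * L r x) μ :=
      ((hLsl r hrS).continuous.mul (hLsl r hrS).continuous).integrable_of_hasCompactSupport
        (HasCompactSupport.of_compactSpace _)
    have hi2 : Integrable (fun x ↦ W r x * LL r x) μ :=
      ((hWsl r hrS).continuous.mul (contMDiff_slice_of_contMDiffOn hLLs hrS).continuous)
        |>.integrable_of_hasCompactSupport (HasCompactSupport.of_compactSpace _)
    rw [integral_add hi1 hi2]
    have hgreen : ∫ x, W r x * LL r x ∂μ = ∫ x, L r x * L r x ∂μ := by
      simp only [hLL, hL]
      exact integral_mul_laplaceBeltrami_comm hg ((hWsl r hrS).of_le h2) ((hLsl r hrS).of_le h2)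
    rw [hgreen, hE₂]
    ring
  have hE₂d : ∀ r ∈ Ioo a b, HasDerivAt E₂ (2 * ∫ x, L r x * LL r x ∂μ) r := by
    intro r hr
    have h1 := hasDerivAt_integral_of_continuousOn_prod μ (S := S)
      (F := fun r x ↦ L r x * L r x) (F' := fun r x ↦ LL r x * L r x + L r x * LL r x)
      (hLc.mul hLc) ((hLLc.mul hLc).add (hLc.mul hLLc))
      (fun x r' hr' ↦ (hLd r' hr' x).mul (hLd r' hr' x)) (hint ▸ hr)
    refine h1.congr_deriv ?_
    rw [← integral_const_mul]
    exact integral_congr_ae (Eventually.of_forall fun x ↦ by ring)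
  have hE₂' : ∀ r ∈ Ioo a b, ∫ x, L r x * LL r x ∂μ ≤ 0 := fun r hr ↦
    integral_mul_laplaceBeltrami_self_nonpos hg ((hLsl r (Ioo_subset_Icc_self hr)).of_le h2)
  -- signs: `J ≤ 0`, `E₀ ≥ 0`
  have hJle : ∀ r ∈ S, J r ≤ 0 := fun r hr ↦
    integral_mul_laplaceBeltrami_self_nonpos hg ((hWsl r hr).of_le h2)
  have hE₀ge : ∀ r, 0 ≤ E₀ r := fun r ↦ integral_nonneg fun x ↦ mul_self_nonneg _
  -- the Lyapunov function `Ψ`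
  set Ψ : ℝ → ℝ := fun σ ↦ (σ - a) ^ 2 * E₂ σ / 2 - (σ - a) * J σ / 2 + E₀ σ / 4 with hΨ
  have hΨd : ∀ σ ∈ Ioo a b, HasDerivAt Ψ ((σ - a) ^ 2 * (2 * ∫ x, L σ x * LL σ x ∂μ) / 2) σ := by
    intro σ hσ
    have hp : HasDerivAt (fun σ : ℝ ↦ (σ - a) ^ 2) (2 * (σ - a)) σ := by
      have h1 := ((hasDerivAt_id σ).sub_const a).mul ((hasDerivAt_id σ).sub_const a)
      have h2 : (fun σ : ℝ ↦ (σ - a) ^ 2) = fun y ↦ (id y - a) * (id y - a) := by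
        funext y; simp only [id]; ring
      rw [h2]
      refine h1.congr_deriv ?_
      simp only [id]; ring
    have hl : HasDerivAt (fun σ : ℝ ↦ σ - a) 1 σ := (hasDerivAt_id σ).sub_const a
    have h := (((hp.mul (hE₂d σ hσ)).div_const 2).sub ((hl.mul (hJd σ hσ)).div_const 2)).add
      ((hE₀d σ hσ).div_const 4)
    refine h.congr_deriv ?_
    ring
  have hΨanti : AntitoneOn Ψ S := by
    refine antitoneOn_of_deriv_nonpos (convex_Icc a b) ?_ ?_ ?_
    · refine ((ContinuousOn.mul ?_ hE₂c).div_const 2 |>.sub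
        ((ContinuousOn.mul ?_ hJc).div_const 2)).add (hE₀c.div_const 4)
      · exact ((continuous_id.sub continuous_const).pow 2).continuousOn
      · exact (continuous_id.sub continuous_const).continuousOn
    · rw [hint]
      exact fun σ hσ ↦ (hΨd σ hσ).differentiableAt.differentiableWithinAt
    · rw [hint]
      intro σ hσ
      rw [(hΨd σ hσ).deriv]
      have := hE₂' σ hσ
      nlinarith [sq_nonneg (σ - a)]
  -- evaluate at the end points
  have hab' : Ψ b ≤ Ψ a := hΨanti (left_mem_Icc.2 hab.le) (right_mem_Icc.2 hab.le) hab.le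
  have hΨa : Ψ a = E₀ a / 4 := by simp [hΨ]
  have hΨb : (b - a) ^ 2 * E₂ b / 2 ≤ Ψ b := by
    have h1 := hJle b (right_mem_Icc.2 hab.le)
    have h2' := hE₀ge b
    have h3 : 0 ≤ (b - a) := by linarith
    simp only [hΨ]
    nlinarith
  have hba : 0 < (b - a) ^ 2 := by positivity
  -- translate back to squares
  have eE₂ : E₂ b = ∫ x, (g.laplaceBeltrami (W b) x) ^ 2 ∂μ :=
    integral_congr_ae (Eventually.of_forall fun x ↦ by simp only [hL]; ring)
  have eE₀ : E₀ a = ∫ x, (W a x) ^ 2 ∂μ :=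
    integral_congr_ae (Eventually.of_forall fun x ↦ by ring)
  rw [← eE₂, ← eE₀, le_div_iff₀ (by positivity)]
  nlinarith

/-! ### Continuous data -/

/-- **`L²` smoothing of the heat flow of a fixed metric**: on a closed Riemannian manifold, for a
continuous datum `φ` with `|φ| ≤ B` and `s < t`,
  `∫ (Δ_g P_{s→t} φ)² dV_g ≤ 2 B² Vol(M) / (t − s)²`
(`integral_sq_laplaceBeltrami_le_of_isHeatSolutionOn` on `[r, t]`, `r = (s+t)/2`, for the smooth
solution started at the smooth datum `P_{s→r}φ`, `|P_{s→r}φ| ≤ B`, which realises `P_{s→t}φ`).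
[cite: Grigoryan2009, §4.3] -/
theorem integral_sq_laplaceBeltrami_heatValueC_le (hg : g.IsRiemannian) {φ : M → ℝ}
    (hφ : Continuous φ) {B : ℝ} (hB : ∀ y, |φ y| ≤ B) {s t : ℝ} (hst : s < t) :
    ∫ x, (g.laplaceBeltrami (fun y ↦ heatValueC (fun _ : ℝ ↦ g) s t y φ) x) ^ 2 ∂g.riemVolume ≤
      2 * B ^ 2 * (g.riemVolume univ).toReal / (t - s) ^ 2 := by
  have hh : IsContMDiffFamilyOn ∞ (fun _ : ℝ ↦ g) univ := isContMDiffFamilyOn_const g univ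
  have hR : ∀ r : ℝ, ((fun _ : ℝ ↦ g) r).IsRiemannian := fun _ ↦ hg
  haveI : IsFiniteMeasure g.riemVolume := ⟨g.riemVolume_univ_lt_top⟩
  set r : ℝ := (s + t) / 2 with hr
  have hsr : s < r := by rw [hr]; linarith
  have hrt : r < t := by rw [hr]; linarith
  -- the smooth intermediate datum `ψ = P_{s→r}φ`, `|ψ| ≤ B`
  set ψ : M → ℝ := fun y ↦ heatValueC (fun _ : ℝ ↦ g) s r y φ with hψ
  have hψs : ContMDiff I 𝓘(ℝ, ℝ) ∞ ψ := contMDiff_heatValueC_slice hh hR hsr hφ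
  have hψB : ∀ y, |ψ y| ≤ B := by
    intro y
    rw [abs_le]
    constructor
    · have h1 := heatValueC_mono hh hR (s := s) (t := r) y continuous_const hφ
        (fun z ↦ (abs_le.1 (hB z)).1)
      rwa [heatValueC_const hh hR] at h1
    · have h1 := heatValueC_mono hh hR (s := s) (t := r) y hφ continuous_const
        (fun z ↦ (abs_le.1 (hB z)).2)
      rwa [heatValueC_const hh hR] at h1
  -- the smooth solution on `[r, t]` started at `ψ`
  obtain ⟨W, hW, hW0, hWv⟩ := exists_isHeatSolutionOn_heatValue hh hR hrt hψs
  have hPt : (fun y ↦ heatValueC (fun _ : ℝ ↦ g) s t y φ) = W t := by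
    funext y
    rw [heatValueC_eq_heatValue_heatValueC hh hR hsr hrt.le y hφ, hWv t ⟨hrt.le, le_rfl⟩ y]
  rw [hPt]
  have key := integral_sq_laplaceBeltrami_le_of_isHeatSolutionOn hg hrt hW
  rw [hW0] at key
  -- `∫ ψ² ≤ B² Vol`
  have hψ2 : ∫ x, (ψ x) ^ 2 ∂g.riemVolume ≤ B ^ 2 * (g.riemVolume univ).toReal := by
    have h1 : ∫ x, (ψ x) ^ 2 ∂g.riemVolume ≤ ∫ _, B ^ 2 ∂g.riemVolume := by
      refine integral_mono_of_nonneg (Eventually.of_forall fun x ↦ sq_nonneg _)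
        (integrable_const _) (Eventually.of_forall fun x ↦ ?_)
      have := hψB x
      exact sq_le_sq' (abs_le.1 this).1 (abs_le.1 this).2
    rwa [integral_const, smul_eq_mul, mul_comm, measureReal_def] at h1
  have htr : t - r = (t - s) / 2 := by rw [hr]; ring
  rw [htr] at key
  have hts : 0 < t - s := by linarith
  calc ∫ x, (g.laplaceBeltrami (W t) x) ^ 2 ∂g.riemVolume
      ≤ (∫ x, (ψ x) ^ 2 ∂g.riemVolume) / (2 * ((t - s) / 2) ^ 2) := key
    _ ≤ (B ^ 2 * (g.riemVolume univ).toReal) / (2 * ((t - s) / 2) ^ 2) :=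
        div_le_div_of_nonneg_right hψ2 (by positivity)
    _ = 2 * B ^ 2 * (g.riemVolume univ).toReal / (t - s) ^ 2 := by
        field_simp

end Literature.Geometry.Riemannian

end
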